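import Mathlib
import Summits.Ventures.PercRepro2.CoinOrTailAlg

/-!
# The tail-mixed values of an OR-tail are log-supermodular — unconditionally (blind cell
PercRepro2, night-2 g10; proofs/NIGHT2-DARC.md §40)

`rVal A r q a ρ τ W = tailWt W · A W + (1 − tailWt W) · A (W ∪ {a})` is the head value averaged
over the two tail coins of the entries `r, q` (`CoinOrTailAlg.lean`); the block theorem of §39
needed its log-supermodularity only on ENTRY-DISJOINT pairs (`rVal_mul_le`: `q ∉ s`, `r ∉ t`).
Here it is proved for ALL pairs `s, t`, together with the gate-side and the mixed forms:
`v_X(s) · v_X(t) ≤ v_{X'}(s ∩ t) · v_X(s ∪ t)` for `X' ⊆ X` (`mixVal_mul_le_all`), where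
`v_X(W) = tailWt W · A W + (1 − tailWt W) · A (W ∪ X)`.

The proof is Ahlswede–Daykin on the EXTENDED LATTICE `Finset V × Bool × Bool`: a point `(W, b, c)`
is a cluster together with the two EFFECTIVE tail coins (`b` = «`r ∈ W` and the coin `r → a` is
open», `c` likewise for `q`), weighted by `effWt ρ (r ∈ W) b · effWt τ (q ∈ W) c` and valued by
the head at `W ∪ X` if an effective coin is open, at `W` otherwise (`extVal`).  The weights are
log-supermodular on the extended lattice (`effWt_mul_le`, sixteen cases), the values are
log-supermodular there because the tail set is added exactly when `b ∨ c` (`headPart_le`: four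
cases, each one log-supermodular step of `A` followed by a monotone step), and the tail-mixed
value `v_X(W)` is the fibre sum over `(b, c)` (`sum_extVal`).  So no entry-disjointness is ever
needed: the obstruction «`1 − tailWt` is not log-supermodular» disappears once the coins are
made explicit.
-/

namespace Summit.Ventures.PercRepro2.Coin

open Classical

section EffWt

variable {R : Type*} [Field R] [LinearOrder R] [IsStrictOrderedRing R]

/-- The weight of an EFFECTIVE tail coin: `x` says the entry is in the cluster, `b` says the
effective coin is open; an absent entry never has an open effective coin. -/
def effWt (ρ : R) (x : Prop) [Decidable x] (b : Bool) : R :=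
  if b then ρ * (if x then 1 else 0) else 1 - ρ * (if x then 1 else 0)

/-- `0 ≤ effWt`. -/
lemma effWt_nonneg {ρ : R} (hρ0 : 0 ≤ ρ) (hρ1 : ρ ≤ 1) (x : Prop) [Decidable x] (b : Bool) :
    0 ≤ effWt ρ x b := by
  by_cases hx : x
  · cases b
    · simp [effWt, hx]; exact hρ1
    · simp [effWt, hx]; exact hρ0
  · cases b <;> simp [effWt, hx]

omit [LinearOrder R] [IsStrictOrderedRing R] in
/-- The two effective-coin weights of an entry sum to `1`. -/
lemma effWt_sum (ρ : R) (x : Prop) [Decidable x] :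
    effWt ρ x false + effWt ρ x true = 1 := by
  by_cases hx : x <;> simp [effWt, hx]

/-- **The effective weights are log-supermodular on the extended lattice**: for the memberships
`x = [r ∈ s]`, `y = [r ∈ t]` and the effective coins `b, c`,
`effWt x b · effWt y c ≤ effWt (x ∧ y) (b ∧ c) · effWt (x ∨ y) (b ∨ c)`. -/
lemma effWt_mul_le {ρ : R} (hρ0 : 0 ≤ ρ) (x y : Prop) [Decidable x] [Decidable y]
    (b c : Bool) :
    effWt ρ x b * effWt ρ y c ≤ effWt ρ (x ∧ y) (b && c) * effWt ρ (x ∨ y) (b || c) := by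
  by_cases hx : x <;> by_cases hy : y <;> cases b <;> cases c <;>
    simp [effWt, hx, hy] <;> nlinarith

end EffWt

section ExtVal

variable {V : Type*} [DecidableEq V] {R : Type*} [Field R] [LinearOrder R] [IsStrictOrderedRing R]

/-- The tail set added for a single effective bit: `X` if the bit is set, `∅` otherwise. -/
def tailAdd' (X : Finset V) : Bool → Finset V
  | true => X
  | false => ∅

/-- The tail set added to a cluster whose effective coins are `b, c`: `X` if one is open. -/
def tailAdd (X : Finset V) (b c : Bool) : Finset V := tailAdd' X (b || c)

/-- The extended value of `(W, b, c)`: the effective weights of the two entries times the head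
value at `W ∪ X` (an effective coin open) or at `W` (none). -/
def extVal (A : Finset V → R) (r q : V) (ρ τ : R) (X : Finset V)
    (a : Finset V × Bool × Bool) : R :=
  effWt ρ (r ∈ a.1) a.2.1 * effWt τ (q ∈ a.1) a.2.2 * A (a.1 ∪ tailAdd X a.2.1 a.2.2)

/-- `0 ≤ extVal`. -/
lemma extVal_nonneg {A : Finset V → R} {r q : V} {ρ τ : R} (hρ0 : 0 ≤ ρ) (hρ1 : ρ ≤ 1)
    (hτ0 : 0 ≤ τ) (hτ1 : τ ≤ 1) (hA0 : ∀ W, 0 ≤ A W) (X : Finset V)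
    (a : Finset V × Bool × Bool) : 0 ≤ extVal A r q ρ τ X a :=
  mul_nonneg (mul_nonneg (effWt_nonneg hρ0 hρ1 _ _) (effWt_nonneg hτ0 hτ1 _ _)) (hA0 _)

omit [LinearOrder R] [IsStrictOrderedRing R] in
/-- **The fibre sum**: summing the extended value over the four effective-coin patterns gives
the tail-mixed value `tailWt W · A W + (1 − tailWt W) · A (W ∪ X)`. -/
lemma sum_extVal (A : Finset V → R) (r q : V) (ρ τ : R) (X : Finset V) (W : Finset V) :
    ∑ bc : Bool × Bool, extVal A r q ρ τ X (W, bc.1, bc.2) =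
      tailWt r q ρ τ W * A W + (1 - tailWt r q ρ τ W) * A (W ∪ X) := by
  rw [Fintype.sum_prod_type]
  simp only [Fintype.sum_bool, extVal, tailAdd, tailAdd', Bool.or_true, Bool.or_false,
    Finset.union_empty]
  by_cases hr : r ∈ W <;> by_cases hq : q ∈ W <;> simp [effWt, tailWt, hr, hq] <;> ring

/-- **The head part of the extended step**: with the tail set added according to the effective
coins, `A (s ∪ X e₁) · A (t ∪ X e₂) ≤ A (s ∩ t ∪ X' e∩) · A (s ∪ t ∪ X e∪)` whenever
`e∪ = e₁ ∨ e₂`, `e∩ → e₁ ∧ e₂` and `X' ⊆ X`. -/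
lemma headPart_le {A : Finset V → R} (hA0 : ∀ W, 0 ≤ A W)
    (hA : ∀ s t : Finset V, A s * A t ≤ A (s ∩ t) * A (s ∪ t))
    (hmono : ∀ s t : Finset V, s ⊆ t → A t ≤ A s) {X X' : Finset V} (hX' : X' ⊆ X)
    (s t : Finset V) (e₁ e₂ e₃ e₄ : Bool) (h₄ : e₄ = (e₁ || e₂))
    (h₃ : e₃ = true → e₁ = true ∧ e₂ = true) :
    A (s ∪ tailAdd' X e₁) * A (t ∪ tailAdd' X e₂) ≤
      A (s ∩ t ∪ tailAdd' X' e₃) * A (s ∪ t ∪ tailAdd' X e₄) := by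
  subst h₄
  cases e₁ <;> cases e₂
  · -- no tail on either side
    have h3 : e₃ = false := by
      cases e₃
      · rfl
      · exact absurd (h₃ rfl).1 Bool.false_ne_true
    subst h3
    simpa only [tailAdd', Bool.or_self, Finset.union_empty] using hA s t
  · -- tail on `t` only
    have h3 : e₃ = false := by
      cases e₃
      · rfl
      · exact absurd (h₃ rfl).1 Bool.false_ne_true
    subst h3
    simp only [tailAdd', Bool.or_true, Finset.union_empty]
    have h1 := hA s (t ∪ X)
    have hsub : s ∩ t ⊆ s ∩ (t ∪ X) := Finset.inter_subset_inter_left Finset.subset_union_left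
    have hU : s ∪ (t ∪ X) = s ∪ t ∪ X := (Finset.union_assoc s t X).symm
    rw [hU] at h1
    calc A s * A (t ∪ X) ≤ A (s ∩ (t ∪ X)) * A (s ∪ t ∪ X) := h1
      _ ≤ A (s ∩ t) * A (s ∪ t ∪ X) :=
          mul_le_mul_of_nonneg_right (hmono _ _ hsub) (hA0 _)
  · -- tail on `s` only
    have h3 : e₃ = false := by
      cases e₃
      · rfl
      · exact absurd (h₃ rfl).2 Bool.false_ne_true
    subst h3
    simp only [tailAdd', Bool.true_or, Finset.union_empty]
    have h1 := hA (s ∪ X) t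
    have hsub : s ∩ t ⊆ (s ∪ X) ∩ t := Finset.inter_subset_inter_right Finset.subset_union_left
    have hU : s ∪ X ∪ t = s ∪ t ∪ X := Finset.union_right_comm s X t
    rw [hU] at h1
    calc A (s ∪ X) * A t ≤ A ((s ∪ X) ∩ t) * A (s ∪ t ∪ X) := h1
      _ ≤ A (s ∩ t) * A (s ∪ t ∪ X) :=
          mul_le_mul_of_nonneg_right (hmono _ _ hsub) (hA0 _)
  · -- tail on both sides
    simp only [tailAdd', Bool.or_self]
    have h1 := hA (s ∪ X) (t ∪ X)
    have hI : (s ∪ X) ∩ (t ∪ X) = s ∩ t ∪ X := by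
      ext x; simp only [Finset.mem_inter, Finset.mem_union]; tauto
    have hU : s ∪ X ∪ (t ∪ X) = s ∪ t ∪ X := by
      ext x; simp only [Finset.mem_union]; tauto
    rw [hI, hU] at h1
    have hsub : s ∩ t ∪ tailAdd' X' e₃ ⊆ s ∩ t ∪ X := by
      apply Finset.union_subset_union_right
      cases e₃
      · exact Finset.empty_subset _
      · exact hX'
    calc A (s ∪ X) * A (t ∪ X) ≤ A (s ∩ t ∪ X) * A (s ∪ t ∪ X) := h1
      _ ≤ A (s ∩ t ∪ tailAdd' X' e₃) * A (s ∪ t ∪ X) :=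
          mul_le_mul_of_nonneg_right (hmono _ _ hsub) (hA0 _)

/-- **The extended values are log-supermodular on the extended lattice** (the mixed form with
`X' ⊆ X` in the meet slot). -/
lemma extVal_mul_le {A : Finset V → R} {r q : V} {ρ τ : R} (hρ0 : 0 ≤ ρ) (hρ1 : ρ ≤ 1)
    (hτ0 : 0 ≤ τ) (hτ1 : τ ≤ 1) (hA0 : ∀ W, 0 ≤ A W)
    (hA : ∀ s t : Finset V, A s * A t ≤ A (s ∩ t) * A (s ∪ t))
    (hmono : ∀ s t : Finset V, s ⊆ t → A t ≤ A s) {X X' : Finset V} (hX' : X' ⊆ X)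
    (a b : Finset V × Bool × Bool) :
    extVal A r q ρ τ X a * extVal A r q ρ τ X b ≤
      extVal A r q ρ τ X' (a ⊓ b) * extVal A r q ρ τ X (a ⊔ b) := by
  obtain ⟨s, b₁, c₁⟩ := a
  obtain ⟨t, b₂, c₂⟩ := b
  have hinf : ((s, b₁, c₁) : Finset V × Bool × Bool) ⊓ (t, b₂, c₂) = (s ∩ t, b₁ && b₂, c₁ && c₂) := by
    cases b₁ <;> cases b₂ <;> cases c₁ <;> cases c₂ <;> rfl
  have hsup : ((s, b₁, c₁) : Finset V × Bool × Bool) ⊔ (t, b₂, c₂) = (s ∪ t, b₁ || b₂, c₁ || c₂) := by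
    cases b₁ <;> cases b₂ <;> cases c₁ <;> cases c₂ <;> rfl
  rw [hinf, hsup]
  simp only [extVal, tailAdd]
  have hr : effWt ρ (r ∈ s ∩ t) (b₁ && b₂) = effWt ρ (r ∈ s ∧ r ∈ t) (b₁ && b₂) := by
    simp only [effWt, Finset.mem_inter]
  have hr' : effWt ρ (r ∈ s ∪ t) (b₁ || b₂) = effWt ρ (r ∈ s ∨ r ∈ t) (b₁ || b₂) := by
    simp only [effWt, Finset.mem_union]
  have hq : effWt τ (q ∈ s ∩ t) (c₁ && c₂) = effWt τ (q ∈ s ∧ q ∈ t) (c₁ && c₂) := by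
    simp only [effWt, Finset.mem_inter]
  have hq' : effWt τ (q ∈ s ∪ t) (c₁ || c₂) = effWt τ (q ∈ s ∨ q ∈ t) (c₁ || c₂) := by
    simp only [effWt, Finset.mem_union]
  rw [hr, hr', hq, hq']
  have hw1 := effWt_mul_le hρ0 (r ∈ s) (r ∈ t) b₁ b₂
  have hw2 := effWt_mul_le hτ0 (q ∈ s) (q ∈ t) c₁ c₂
  have hhead := headPart_le hA0 hA hmono hX' s t (b₁ || c₁) (b₂ || c₂)
    ((b₁ && b₂) || (c₁ && c₂)) ((b₁ || b₂) || (c₁ || c₂)) (by cases b₁ <;> cases b₂ <;> cases c₁ <;> cases c₂ <;> rfl)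
    (by cases b₁ <;> cases b₂ <;> cases c₁ <;> cases c₂ <;> simp)
  have e0 : ∀ (x : Prop) [Decidable x] (b : Bool), 0 ≤ effWt ρ x b := effWt_nonneg hρ0 hρ1
  have e0' : ∀ (x : Prop) [Decidable x] (b : Bool), 0 ≤ effWt τ x b := effWt_nonneg hτ0 hτ1
  calc effWt ρ (r ∈ s) b₁ * effWt τ (q ∈ s) c₁ * A (s ∪ tailAdd' X (b₁ || c₁)) *
        (effWt ρ (r ∈ t) b₂ * effWt τ (q ∈ t) c₂ * A (t ∪ tailAdd' X (b₂ || c₂)))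
      = (effWt ρ (r ∈ s) b₁ * effWt ρ (r ∈ t) b₂) * (effWt τ (q ∈ s) c₁ * effWt τ (q ∈ t) c₂) *
          (A (s ∪ tailAdd' X (b₁ || c₁)) * A (t ∪ tailAdd' X (b₂ || c₂))) := by ring
    _ ≤ (effWt ρ (r ∈ s ∧ r ∈ t) (b₁ && b₂) * effWt ρ (r ∈ s ∨ r ∈ t) (b₁ || b₂)) *
          (effWt τ (q ∈ s ∧ q ∈ t) (c₁ && c₂) * effWt τ (q ∈ s ∨ q ∈ t) (c₁ || c₂)) *
          (A (s ∩ t ∪ tailAdd' X' ((b₁ && b₂) || (c₁ && c₂))) *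
            A (s ∪ t ∪ tailAdd' X ((b₁ || b₂) || (c₁ || c₂)))) := by
        apply mul_le_mul
        · apply mul_le_mul hw1 hw2
          · exact mul_nonneg (e0' _ _) (e0' _ _)
          · exact mul_nonneg (e0 _ _) (e0 _ _)
        · exact hhead
        · exact mul_nonneg (hA0 _) (hA0 _)
        · exact mul_nonneg (mul_nonneg (e0 _ _) (e0 _ _)) (mul_nonneg (e0' _ _) (e0' _ _))
    _ = effWt ρ (r ∈ s ∧ r ∈ t) (b₁ && b₂) * effWt τ (q ∈ s ∧ q ∈ t) (c₁ && c₂) *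
          A (s ∩ t ∪ tailAdd' X' ((b₁ && b₂) || (c₁ && c₂))) *
          (effWt ρ (r ∈ s ∨ r ∈ t) (b₁ || b₂) * effWt τ (q ∈ s ∨ q ∈ t) (c₁ || c₂) *
            A (s ∪ t ∪ tailAdd' X ((b₁ || b₂) || (c₁ || c₂)))) := by ring

end ExtVal

section MixLsm

variable {V : Type*} [Fintype V] [DecidableEq V] {R : Type*} [Field R] [LinearOrder R]
  [IsStrictOrderedRing R]

/-- **THE TAIL-MIXED VALUES ARE LOG-SUPERMODULAR, UNCONDITIONALLY** (mixed form): for `X' ⊆ X`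
and ANY `s, t`, `v_X(s) · v_X(t) ≤ v_{X'}(s ∩ t) · v_X(s ∪ t)` with
`v_X(W) = tailWt W · A W + (1 − tailWt W) · A (W ∪ X)`.  Ahlswede–Daykin on the extended
lattice `Finset V × Bool × Bool`. -/
theorem mixVal_mul_le_all (A : Finset V → R) (r q : V) (ρ τ : R) {X X' : Finset V}
    (hX' : X' ⊆ X) (hρ0 : 0 ≤ ρ) (hρ1 : ρ ≤ 1) (hτ0 : 0 ≤ τ) (hτ1 : τ ≤ 1)
    (hA0 : ∀ W, 0 ≤ A W) (hA : ∀ s t : Finset V, A s * A t ≤ A (s ∩ t) * A (s ∪ t))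
    (hmono : ∀ s t : Finset V, s ⊆ t → A t ≤ A s) (s t : Finset V) :
    (tailWt r q ρ τ s * A s + (1 - tailWt r q ρ τ s) * A (s ∪ X)) *
      (tailWt r q ρ τ t * A t + (1 - tailWt r q ρ τ t) * A (t ∪ X)) ≤
    (tailWt r q ρ τ (s ∩ t) * A (s ∩ t) + (1 - tailWt r q ρ τ (s ∩ t)) * A (s ∩ t ∪ X')) *
      (tailWt r q ρ τ (s ∪ t) * A (s ∪ t) + (1 - tailWt r q ρ τ (s ∪ t)) * A (s ∪ t ∪ X)) := by
  let f₁ : Finset V × Bool × Bool → R := fun a => if a.1 = s then extVal A r q ρ τ X a else 0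
  let f₂ : Finset V × Bool × Bool → R := fun a => if a.1 = t then extVal A r q ρ τ X a else 0
  let f₃ : Finset V × Bool × Bool → R :=
    fun a => if a.1 = s ∩ t then extVal A r q ρ τ X' a else 0
  let f₄ : Finset V × Bool × Bool → R :=
    fun a => if a.1 = s ∪ t then extVal A r q ρ τ X a else 0
  have h₁ : 0 ≤ f₁ := fun a => by
    simp only [f₁]; split_ifs
    · exact extVal_nonneg hρ0 hρ1 hτ0 hτ1 hA0 _ _
    · exact le_rfl
  have h₂ : 0 ≤ f₂ := fun a => by
    simp only [f₂]; split_ifs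
    · exact extVal_nonneg hρ0 hρ1 hτ0 hτ1 hA0 _ _
    · exact le_rfl
  have h₃ : 0 ≤ f₃ := fun a => by
    simp only [f₃]; split_ifs
    · exact extVal_nonneg hρ0 hρ1 hτ0 hτ1 hA0 _ _
    · exact le_rfl
  have h₄ : 0 ≤ f₄ := fun a => by
    simp only [f₄]; split_ifs
    · exact extVal_nonneg hρ0 hρ1 hτ0 hτ1 hA0 _ _
    · exact le_rfl
  have h : ∀ a b, f₁ a * f₂ b ≤ f₃ (a ⊓ b) * f₄ (a ⊔ b) := by
    intro a b
    simp only [f₁, f₂, f₃, f₄]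
    by_cases ha : a.1 = s
    · by_cases hb : b.1 = t
      · have hab1 : (a ⊓ b).1 = s ∩ t := by rw [Prod.inf_def]; simp [ha, hb]
        have hab2 : (a ⊔ b).1 = s ∪ t := by rw [Prod.sup_def]; simp [ha, hb]
        rw [if_pos ha, if_pos hb, if_pos hab1, if_pos hab2]
        exact extVal_mul_le hρ0 hρ1 hτ0 hτ1 hA0 hA hmono hX' a b
      · rw [if_neg hb, mul_zero]
        exact mul_nonneg (h₃ _) (h₄ _)
    · rw [if_neg ha, zero_mul]
      exact mul_nonneg (h₃ _) (h₄ _)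
  have key := four_functions_theorem_univ f₁ f₂ f₃ f₄ h₁ h₂ h₃ h₄ h
  have hsum : ∀ (Y W : Finset V),
      (∑ a : Finset V × Bool × Bool, if a.1 = W then extVal A r q ρ τ Y a else 0) =
        tailWt r q ρ τ W * A W + (1 - tailWt r q ρ τ W) * A (W ∪ Y) := by
    intro Y W
    rw [← sum_extVal A r q ρ τ Y W, Fintype.sum_prod_type, Finset.sum_comm]
    simp only [Finset.sum_ite_eq', Finset.mem_univ, if_true]
  simp only [f₁, f₂, f₃, f₄] at key
  rwa [hsum, hsum, hsum, hsum] at key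

/-- `rVal` is log-supermodular on ALL pairs. -/
theorem rVal_mul_le_all (A : Finset V → R) (r q a : V) (ρ τ : R) (hρ0 : 0 ≤ ρ) (hρ1 : ρ ≤ 1)
    (hτ0 : 0 ≤ τ) (hτ1 : τ ≤ 1) (hA0 : ∀ W, 0 ≤ A W)
    (hA : ∀ s t : Finset V, A s * A t ≤ A (s ∩ t) * A (s ∪ t))
    (hmono : ∀ s t : Finset V, s ⊆ t → A t ≤ A s) (s t : Finset V) :
    rVal A r q a ρ τ s * rVal A r q a ρ τ t ≤
      rVal A r q a ρ τ (s ∩ t) * rVal A r q a ρ τ (s ∪ t) :=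
  mixVal_mul_le_all A r q ρ τ (Finset.Subset.refl {a}) hρ0 hρ1 hτ0 hτ1 hA0 hA hmono s t

/-- `gVal` is log-supermodular on ALL pairs. -/
theorem gVal_mul_le_all (A : Finset V → R) (r q a w : V) (ρ τ : R) (hρ0 : 0 ≤ ρ) (hρ1 : ρ ≤ 1)
    (hτ0 : 0 ≤ τ) (hτ1 : τ ≤ 1) (hA0 : ∀ W, 0 ≤ A W)
    (hA : ∀ s t : Finset V, A s * A t ≤ A (s ∩ t) * A (s ∪ t))
    (hmono : ∀ s t : Finset V, s ⊆ t → A t ≤ A s) (s t : Finset V) :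
    gVal A r q a w ρ τ s * gVal A r q a w ρ τ t ≤
      gVal A r q a w ρ τ (s ∩ t) * gVal A r q a w ρ τ (s ∪ t) :=
  mixVal_mul_le_all A r q ρ τ (Finset.Subset.refl {a, w}) hρ0 hρ1 hτ0 hτ1 hA0 hA hmono s t

/-- The mixed step on ALL pairs: `gVal s · gVal t ≤ rVal (s ∩ t) · gVal (s ∪ t)`. -/
theorem gVal_mul_le_rVal_gVal_all (A : Finset V → R) (r q a w : V) (ρ τ : R) (hρ0 : 0 ≤ ρ)
    (hρ1 : ρ ≤ 1) (hτ0 : 0 ≤ τ) (hτ1 : τ ≤ 1) (hA0 : ∀ W, 0 ≤ A W)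
    (hA : ∀ s t : Finset V, A s * A t ≤ A (s ∩ t) * A (s ∪ t))
    (hmono : ∀ s t : Finset V, s ⊆ t → A t ≤ A s) (s t : Finset V) :
    gVal A r q a w ρ τ s * gVal A r q a w ρ τ t ≤
      rVal A r q a ρ τ (s ∩ t) * gVal A r q a w ρ τ (s ∪ t) :=
  mixVal_mul_le_all A r q ρ τ
    (Finset.singleton_subset_iff.2 (Finset.mem_insert_self a {w})) hρ0 hρ1 hτ0 hτ1 hA0 hA hmono
    s t

end MixLsm

end Summit.Ventures.PercRepro2.Coin
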